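import Mathlib
import Summits.Ventures.PercRepro2.ThreeTypedAbstract

/-!
# Three typed edges, shards 11/11 (blind cell PercRepro2, night-3, 2026-08-24)

`decide +kernel` of the shards `shard a1 … a5 = true` of `allOk3` for the canonical prefixes listed
below (1 shards, 20878 labellings of the eleven points in this file).
-/

set_option Elab.async false

namespace Summit.Ventures.PercRepro2

open UnionCluster

namespace CovForm

namespace TwoTyped

open OneTyped

set_option maxHeartbeats 0 in
/-- Shard `(1, 2, 3, 4, 5)` (20878 labellings). -/
theorem sh_1_2_3_4_5 : shard 1 2 3 4 5 = true := by
  decide +kernel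

end TwoTyped

end CovForm

end Summit.Ventures.PercRepro2
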